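import Mathlib
import Literature.Analysis.Quadrature.OwenLemma

/-!
# Variance of the scrambled-net estimator; scrambled `(t, m, 1)`-nets

Let `N` points `x_0, …, x_{N-1} ∈ [0,1)` with base-`b` digit sequences `ξ_0, …, ξ_{N-1}` be
randomised by ONE nested uniform scramble `Π` (Owen's scrambling [Dick–Pillichshammer 2010, §13.1];
`scrambleDigits`, `scrambleMeasure` of `Literature.Analysis.Quadrature.OwenScrambling`),
`y_n = (x_n)_Π`, and let `Î(f) = (1/N) Σ_n f(y_n)` be the randomised QMC estimator
[DP2010, eq. (13.7)].  For `f` with Walsh coefficients `f̂(k)` the nested ANOVA variances are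
`σ_ℓ²(f) = Σ_{b^{ℓ-1} ≤ k < b^ℓ} |f̂(k)|²` [DP2010, eq. (13.5)], and with
`M_w = #{(n, n') : ⌊b^w x_n⌋ = ⌊b^w x_{n'}⌋}` (`prefixPairCount` of
`Literature.Analysis.Quadrature.OwenLemma`) Owen's lemma summed over the point family gives the
**variance of the scrambled estimator** [DP2010, Cor. 13.4]
`Var[Î(f)] = N⁻² Σ_{ℓ ≥ 1} (b M_ℓ - M_{ℓ-1})/(b - 1) · σ_ℓ²(f)`.
For a `(t, m, 1)`-net in base `b` (`N = b^m` points, every `b`-adic elementary interval of order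
`m - t` containing exactly `b^t` of them [DP2010, Def. 4.7, Remark 4.9]) one has `M_ℓ = b^{2m-ℓ}`
for `ℓ ≤ m - t`, so the factor vanishes there, and [DP2010, Thm. 13.5]
`Var[Î(f)] = b^{-m} Σ_{ℓ > m} σ_ℓ²(f)` for a `(0, m, 1)`-net,
`Var[Î(f)] ≤ b^{t-m} Σ_{ℓ > m-t} σ_ℓ²(f)` for a `(t, m, 1)`-net
(always below the Monte Carlo variance `N⁻¹ Σ_{ℓ ≥ 1} σ_ℓ²(f)`).

We formalise this on the digit space `ℕ → Fin b` (digit `i` in Lean = digit `i+1` of the book), for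
`b ≥ 2` (`1 < b`; primality of `b`, assumed throughout [DP2010, §13.3], is not needed for these
statements) and for WALSH POLYNOMIALS `f = Σ_{k < b^L} c_k wal_k` (`walshPoly`; `f̂(k) = c_k`,
`∫ f = c_0`):

* `blockVariance` (`σ_ℓ²`), `gainFactor` (`(b M_ℓ - M_{ℓ-1})/(b - 1)`), `scrambledAverage` (`Î`);
* `integral_walshD_scrambleDigits` — `E[wal_k(ξ_Π)] = [k = 0]`, and
  `integral_scrambledAverage_walshPoly` — **unbiasedness** `E[Î(f)] = c_0` [DP2010, Prop. 13.1
  and the display following it in §13.1];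
* `integral_norm_sq_scrambledAverage_sub` — **Corollary 13.4**:
  `E|Î(f) - c_0|² = N⁻² Σ_{ℓ=1}^{L} (b M_ℓ - M_{ℓ-1})/(b - 1) · σ_ℓ²(f)`;
* `IsDigitNet b t m ξ` — the `(t, m, 1)`-net property of a family of digit sequences
  [DP2010, Def. 4.7 with Remark 4.9 (1), `s = 1`]; `IsDigitNet.card_filter_digitsPrefix_eq` —
  fairness at every order `w ≤ m - t` [DP2010, Remark 4.9 (2)]; `gainFactor_le_prefixPairCount`
  (the factor is `≤ M_ℓ`, as `M_w` is non-increasing in `w`); `IsDigitNet.prefixPairCount_eq`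
  (`M_w = b^{2m-w}`, `w ≤ m - t`),
  `IsDigitNet.prefixPairCount_eq_of_le` (`M_w = b^m`, `w ≥ m`, `t = 0`),
  `IsDigitNet.gainFactor_eq_zero` / `gainFactor_le` / `gainFactor_eq_pow` — the case analysis of
  the proof of Theorem 13.5;
* `IsDigitNet.integral_norm_sq_scrambledAverage_sub_eq` — **Theorem 13.5** for `(0, m, 1)`-nets,
  `E|Î(f) - c_0|² = b^{-m} Σ_{m < ℓ ≤ L} σ_ℓ²(f)`;
  `IsDigitNet.integral_norm_sq_scrambledAverage_sub_le` — **Theorem 13.5** for `(t, m, 1)`-nets,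
  `E|Î(f) - c_0|² ≤ b^t/b^m · Σ_{m-t < ℓ ≤ L} σ_ℓ²(f)`.

Design.  As in `OwenScrambling` / `OwenLemma`, everything is stated where the scramble acts, on
digit sequences, with `walshD b k` of `Literature.Analysis.Quadrature.DigitalNets`; the elementary
interval `[A b^{-w}, (A+1) b^{-w})` becomes a prescribed digit prefix `digitsPrefix b w`.  The book
states Corollary 13.4 and Theorem 13.5 for `f ∈ L_2([0,1])` with `Σ_{ℓ ≥ 1}`; the reduction to the
finite Walsh sums treated here is Parseval's identity for the Walsh system [DP2010, (13.6)], which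
is not formalised in this file — for a Walsh polynomial of degree `< b^L` all `σ_ℓ²` with `ℓ > L`
vanish and the statements below are literally the book's.  The variance is rendered as the second
moment `E|Î(f) - c_0|²` about the (proved) mean `c_0`.  Proofs follow the book: expand
`|Σ_k c_k A_k(Π)|²` with `A_k(Π) = Σ_n wal_k(ξ_{n,Π})`, kill the off-diagonal terms and evaluate
the diagonal ones by Owen's lemma (`sum_sum_integral_walshD_scrambleDigits_mul_conj`), regroup the
wavenumbers `1 ≤ k < b^L` by digit length; for nets, count prefixes (an order-`(k-1)` prefix class
is the disjoint union of its `b` order-`k` extensions).  Deliberately NOT here: the `L_2` /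
Parseval passage, the multivariate gain coefficients `Γ_𝓵` and Theorem 13.6 / Corollary 13.7
(§13.3.2), and the improved rates for smooth integrands (§13.4).

## References

* J. Dick, F. Pillichshammer, *Digital Nets and Sequences. Discrepancy Theory and Quasi–Monte Carlo
  Integration*, Cambridge University Press 2010: §4.2 Definition 4.7, Remark 4.9; §13.1
  Proposition 13.1, eq. (13.7); §13.2 eq. (13.5); §13.3.1 Lemma 13.3, Corollary 13.4,
  Theorem 13.5. [DickPillichshammer2010, Thm. 13.5]
* A. B. Owen, *Monte Carlo variance of scrambled net quadrature*, SIAM J. Numer. Anal. 34 (1997),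
  1884–1910; *Scrambled net variance for integrals of smooth functions*, Ann. Statist. 25 (1997),
  1541–1562 (the originals of Lemma 13.3 / Theorem 13.5; cited through [DP2010, refs. 207, 208]).

AI-produced formalisation (H21 engines group, seat eng-quad-1, 2026-08-21); no facts, no axioms
beyond Mathlib's, no `sorry`.
-/

open MeasureTheory Complex Finset
open scoped ENNReal ComplexConjugate

noncomputable section

namespace Literature.Analysis.Quadrature

variable (b : ℕ)

/-! ### Walsh polynomials on the digit space and the nested ANOVA variances `σ_ℓ²` -/

/-- A **Walsh polynomial** of degree `< b^L` on the digit space: `f = Σ_{0 ≤ k < b^L} c_k wal_k`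
(a finite Walsh series [cite: DickPillichshammer2010, eq. (13.4)] with `f̂(k) = c_k`). -/
def walshPoly [NeZero b] (L : ℕ) (c : ℕ → ℂ) (η : ℕ → Fin b) : ℂ :=
  ∑ k ∈ range (b ^ L), c k * walshD b k η

/-- The **nested ANOVA variances** `σ_ℓ²(f) = Var[β_ℓ] = Σ_{b^{ℓ-1} ≤ k < b^ℓ} |f̂(k)|²`, `ℓ ≥ 1`,
of a function with Walsh coefficients `f̂(k) = c_k` [cite: DickPillichshammer2010, eq. (13.5)]
(and the display following it; for `ℓ = 0` the block is empty and the value is `0`). -/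
def blockVariance (c : ℕ → ℂ) (ℓ : ℕ) : ℝ :=
  ∑ k ∈ Ico (b ^ (ℓ - 1)) (b ^ ℓ), ‖c k‖ ^ 2

/-- `σ_ℓ² ≥ 0`. [folklore] -/
private theorem blockVariance_nonneg (c : ℕ → ℂ) (ℓ : ℕ) : 0 ≤ blockVariance b c ℓ :=
  sum_nonneg fun _ _ => by positivity

section Family

variable {κ : Type*} [Fintype κ]

/-- The factor `(b M_ℓ - M_{ℓ-1})/(b - 1)` multiplying `σ_ℓ²(f)` in the variance of the scrambled
estimator [cite: DickPillichshammer2010, Cor. 13.4] (`M_w = prefixPairCount b w ξ`, the number of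
ordered pairs of points sharing their first `w` digits; in dimension one `N^{-2}` times this factor
is the number `G_ℓ` of §13.3.2). -/
def gainFactor (ℓ : ℕ) (ξ : κ → ℕ → Fin b) : ℝ :=
  ((b : ℝ) * prefixPairCount b ℓ ξ - prefixPairCount b (ℓ - 1) ξ) / ((b : ℝ) - 1)

/-- The randomised QMC estimator `Î(f) = (1/N) Σ_{n<N} f(y_n)` over the scrambled points
`y_n = (x_n)_Π`, on the digit space (`ξ n` = the digit sequence of `x_n`, all points scrambled by
the SAME nested scramble `Π`). [cite: DickPillichshammer2010, eq. (13.7)] -/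
def scrambledAverage (π : Scramble b) (ξ : κ → ℕ → Fin b) (f : (ℕ → Fin b) → ℂ) : ℂ :=
  ((Fintype.card κ : ℂ)⁻¹) * ∑ n, f (scrambleDigits b π (ξ n))

end Family

/-! ### Measurability and integrability against the scramble law -/

/-- For a fixed digit sequence, the scrambled digits depend measurably on the scramble.
[folklore] -/
private theorem measurable_scrambleDigits_left (ξ : ℕ → Fin b) :
    Measurable fun π : Scramble b => scrambleDigits b π ξ :=
  measurable_pi_lambda _ fun k =>
    (measurable_from_top (f := fun p : Equiv.Perm (Fin b) => p (ξ k))).comp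
      (measurable_pi_apply (⟨k, digitsPrefix b k ξ⟩ : (k : ℕ) × (Fin k → Fin b)))

/-- `Π ↦ wal_k(ξ_Π)` is measurable. [folklore] -/
private theorem measurable_walshD_scrambleDigits [NeZero b] (k : ℕ) (ξ : ℕ → Fin b) :
    Measurable fun π : Scramble b => walshD b k (scrambleDigits b π ξ) :=
  (measurable_walshD k).comp (measurable_scrambleDigits_left b ξ)

/-- A measurable function bounded in norm is integrable against the (probability) scramble law.
[folklore] -/
private theorem integrable_of_norm_le {F : Scramble b → ℂ} (hF : Measurable F) {C : ℝ}
    (hC : ∀ π, ‖F π‖ ≤ C) : Integrable F (scrambleMeasure b) :=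
  (integrable_const C).mono' hF.aestronglyMeasurable (ae_of_all _ hC)

section Family

variable {κ : Type*} [Fintype κ]

/-- The point sums `A_k(Π) = Σ_n wal_k(ξ_{n,Π})`. [folklore] -/
private theorem measurable_sum_walshD [NeZero b] (k : ℕ) (ξ : κ → ℕ → Fin b) :
    Measurable fun π : Scramble b => ∑ n, walshD b k (scrambleDigits b π (ξ n)) :=
  Finset.measurable_sum _ fun n _ => measurable_walshD_scrambleDigits b k (ξ n)

/-- `|A_k(Π)| ≤ N`. [folklore] -/
private theorem norm_sum_walshD_le [NeZero b] (k : ℕ) (ξ : κ → ℕ → Fin b) (π : Scramble b) :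
    ‖∑ n, walshD b k (scrambleDigits b π (ξ n))‖ ≤ Fintype.card κ := by
  calc ‖∑ n, walshD b k (scrambleDigits b π (ξ n))‖
      ≤ ∑ n : κ, ‖walshD b k (scrambleDigits b π (ξ n))‖ := norm_sum_le _ _
    _ = ∑ n : κ, (1 : ℝ) := by simp_rw [norm_walshD]
    _ = Fintype.card κ := by simp

/-- `Π ↦ A_k(Π) conj A_{k'}(Π)` is integrable. [folklore] -/
private theorem integrable_sum_walshD_mul_conj [NeZero b] (k k' : ℕ) (ξ : κ → ℕ → Fin b) :
    Integrable (fun π : Scramble b => (∑ n, walshD b k (scrambleDigits b π (ξ n))) *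
      conj (∑ n, walshD b k' (scrambleDigits b π (ξ n)))) (scrambleMeasure b) := by
  refine integrable_of_norm_le b ((measurable_sum_walshD b k ξ).mul
    (continuous_conj.measurable.comp (measurable_sum_walshD b k' ξ)))
    (C := (Fintype.card κ : ℝ) * Fintype.card κ) fun π => ?_
  rw [norm_mul, RCLike.norm_conj]
  exact mul_le_mul (norm_sum_walshD_le b k ξ π) (norm_sum_walshD_le b k' ξ π) (norm_nonneg _)
    (Nat.cast_nonneg _)

/-- `Π ↦ wal_k(ξ_{n,Π}) conj wal_{k'}(ξ_{n',Π})` is integrable. [folklore] -/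
private theorem integrable_walshD_mul_conj [NeZero b] (k k' : ℕ) (ξ ξ' : ℕ → Fin b) :
    Integrable (fun π : Scramble b => walshD b k (scrambleDigits b π ξ) *
      conj (walshD b k' (scrambleDigits b π ξ'))) (scrambleMeasure b) := by
  refine integrable_of_norm_le b ((measurable_walshD_scrambleDigits b k ξ).mul
    (continuous_conj.measurable.comp (measurable_walshD_scrambleDigits b k' ξ'))) (C := 1)
    fun π => ?_
  rw [norm_mul, RCLike.norm_conj, norm_walshD, norm_walshD, mul_one]

/-! ### Unbiasedness on Walsh polynomials -/

/-- `E[wal_k(ξ_Π)] = [k = 0]`: a scrambled point has i.i.d. uniform digits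
[cite: DickPillichshammer2010, Prop. 13.1], and `∫ wal_k = [k = 0]`
[cite: DickPillichshammer2010, Prop. A.10]. -/
theorem integral_walshD_scrambleDigits [NeZero b] (hb : 1 < b) (ξ : ℕ → Fin b) (k : ℕ) :
    ∫ π, walshD b k (scrambleDigits b π ξ) ∂scrambleMeasure b = if k = 0 then 1 else 0 := by
  have h := integral_walshD_scrambleDigits_mul_conj_self b hb ξ k 0
  simpa only [walshD_zero, map_one, mul_one] using h

/-- **Unbiasedness** of the scrambled estimator on a Walsh polynomial: `E[Î(f)] = f̂(0) = ∫ f`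
[cite: DickPillichshammer2010, Prop. 13.1] (and the display following it in §13.1, "yields an
unbiased estimator"; here for `f = Σ_{k < b^L} c_k wal_k` on the digit space). -/
theorem integral_scrambledAverage_walshPoly [NeZero b] (hb : 1 < b) [Nonempty κ]
    (ξ : κ → ℕ → Fin b) (L : ℕ) (c : ℕ → ℂ) :
    ∫ π, scrambledAverage b π ξ (walshPoly b L c) ∂scrambleMeasure b = c 0 := by
  have hint : ∀ n k, Integrable (fun π : Scramble b => c k * walshD b k (scrambleDigits b π (ξ n)))
      (scrambleMeasure b) := fun n k =>
    (integrable_of_norm_le b (measurable_walshD_scrambleDigits b k (ξ n)) (C := 1)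
      fun π => (norm_walshD _ _).le).const_mul (c k)
  simp only [scrambledAverage, walshPoly]
  rw [integral_const_mul,
    integral_finsetSum _ fun n _ => integrable_finsetSum _ fun k _ => hint n k]
  simp_rw [integral_finsetSum _ fun k _ => hint _ k, integral_const_mul,
    integral_walshD_scrambleDigits b hb, mul_ite, mul_one, mul_zero, Finset.sum_ite_eq', mem_range,
    if_pos (Nat.pow_pos (Nat.pos_of_ne_zero (NeZero.ne b)))]
  rw [Finset.sum_const, Finset.card_univ, nsmul_eq_mul, ← mul_assoc,
    inv_mul_cancel₀ (Nat.cast_ne_zero.2 Fintype.card_ne_zero), one_mul]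

/-! ### Corollary 13.4: the variance of the scrambled estimator -/

/-- Second moments of the point sums `A_k(Π) = Σ_n wal_k(ξ_{n,Π})`: `E[A_k conj A_{k'}]` is the
double sum of the pair moments of Owen's lemma. [folklore] -/
private theorem integral_sum_mul_conj_sum [NeZero b] (ξ : κ → ℕ → Fin b) (k k' : ℕ) :
    ∫ π, (∑ n, walshD b k (scrambleDigits b π (ξ n))) *
        conj (∑ n, walshD b k' (scrambleDigits b π (ξ n))) ∂scrambleMeasure b =
      ∑ n, ∑ n', ∫ π, walshD b k (scrambleDigits b π (ξ n)) *
        conj (walshD b k' (scrambleDigits b π (ξ n'))) ∂scrambleMeasure b := by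
  simp_rw [map_sum, Finset.sum_mul_sum]
  rw [integral_finsetSum _ fun n _ =>
    integrable_finsetSum _ fun n' _ => integrable_walshD_mul_conj b k k' (ξ n) (ξ n')]
  exact Finset.sum_congr rfl fun n _ =>
    integral_finsetSum _ fun n' _ => integrable_walshD_mul_conj b k k' (ξ n) (ξ n')

/-- Off the diagonal the second moments vanish [cite: DickPillichshammer2010, Lemma 13.3]
(`k ≠ k'`). -/
private theorem integral_sum_mul_conj_sum_of_ne [NeZero b] (hb : 1 < b) (ξ : κ → ℕ → Fin b)
    {k k' : ℕ} (hkk : k ≠ k') :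
    ∫ π, (∑ n, walshD b k (scrambleDigits b π (ξ n))) *
        conj (∑ n, walshD b k' (scrambleDigits b π (ξ n))) ∂scrambleMeasure b = 0 := by
  rw [integral_sum_mul_conj_sum b ξ k k']
  exact Finset.sum_eq_zero fun n _ => Finset.sum_eq_zero fun n' _ =>
    integral_walshD_scrambleDigits_mul_conj_of_ne b hb (ξ n) (ξ n') hkk

/-- On the diagonal, for `k` with exactly `ℓ` digits, `E|A_k|² = (b M_ℓ - M_{ℓ-1})/(b - 1)`
[cite: DickPillichshammer2010, Lemma 13.3] (summed form). -/
private theorem integral_sum_mul_conj_sum_self [NeZero b] (hb : 1 < b) (ξ : κ → ℕ → Fin b)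
    {k ℓ : ℕ} (hk : b ^ (ℓ - 1) ≤ k) (hk' : k < b ^ ℓ) :
    ∫ π, (∑ n, walshD b k (scrambleDigits b π (ξ n))) *
        conj (∑ n, walshD b k (scrambleDigits b π (ξ n))) ∂scrambleMeasure b =
      ((b : ℂ) * prefixPairCount b ℓ ξ - prefixPairCount b (ℓ - 1) ξ) / ((b : ℂ) - 1) := by
  rw [integral_sum_mul_conj_sum b ξ k k,
    sum_sum_integral_walshD_scrambleDigits_mul_conj b hb ξ hk hk']

omit [Fintype κ] in
/-- The wavenumbers `1 ≤ k < b^L` split into the digit-length blocks `b^{ℓ-1} ≤ k < b^ℓ`,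
`1 ≤ ℓ ≤ L`. [folklore] -/
private theorem sum_Ico_one_pow [NeZero b] {M : Type*} [AddCommMonoid M] (F : ℕ → M) (L : ℕ) :
    ∑ k ∈ Ico 1 (b ^ L), F k = ∑ ℓ ∈ Icc 1 L, ∑ k ∈ Ico (b ^ (ℓ - 1)) (b ^ ℓ), F k := by
  have hb0 : 0 < b := Nat.pos_of_ne_zero (NeZero.ne b)
  induction L with
  | zero => simp
  | succ L ih =>
    rw [← Finset.sum_Ico_consecutive F (Nat.one_le_pow _ _ hb0)
        (Nat.pow_le_pow_right hb0 L.le_succ), ih, Finset.sum_Icc_succ_top (by omega : 1 ≤ L + 1),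
      Nat.add_sub_cancel]

/-- The gain factor, cast to `ℂ`. [folklore] -/
private theorem gainFactor_cast (ℓ : ℕ) (ξ : κ → ℕ → Fin b) :
    ((gainFactor b ℓ ξ : ℝ) : ℂ) =
      ((b : ℂ) * prefixPairCount b ℓ ξ - prefixPairCount b (ℓ - 1) ξ) / ((b : ℂ) - 1) := by
  unfold gainFactor; push_cast; rfl

/-- The heart of [cite: DickPillichshammer2010, Cor. 13.4]: for `S(Π) = Σ_{1 ≤ k < b^L} c_k A_k(Π)`,
`E|S|² = Σ_{ℓ=1}^{L} (b M_ℓ - M_{ℓ-1})/(b-1) σ_ℓ²`. -/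
private theorem integral_norm_sq_sum [NeZero b] (hb : 1 < b) (ξ : κ → ℕ → Fin b) (L : ℕ)
    (c : ℕ → ℂ) :
    ∫ π, ‖∑ k ∈ Ico 1 (b ^ L), c k * ∑ n, walshD b k (scrambleDigits b π (ξ n))‖ ^ 2
        ∂scrambleMeasure b =
      ∑ ℓ ∈ Icc 1 L, gainFactor b ℓ ξ * blockVariance b c ℓ := by
  have hint : ∀ k k', Integrable (fun π => (c k * conj (c k')) *
      ((∑ n, walshD b k (scrambleDigits b π (ξ n))) *
        conj (∑ n, walshD b k' (scrambleDigits b π (ξ n))))) (scrambleMeasure b) :=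
    fun k k' => (integrable_sum_walshD_mul_conj b k k' ξ).const_mul _
  -- pass to `ℂ`, where `|S|² = S conj S`
  apply Complex.ofReal_injective
  rw [← integral_complex_ofReal]
  push_cast
  simp_rw [← Complex.mul_conj', map_sum, map_mul, Finset.sum_mul_sum,
    mul_mul_mul_comm (c _) (∑ n, walshD b _ (scrambleDigits b _ (ξ n)))]
  rw [integral_finsetSum _ fun k _ => integrable_finsetSum _ fun k' _ => hint k k']
  simp_rw [integral_finsetSum _ fun k' _ => hint _ k', integral_const_mul]
  -- the off-diagonal terms vanish
  rw [Finset.sum_congr rfl fun k hk => Finset.sum_eq_single_of_mem k hk fun k' _ hne => by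
    rw [integral_sum_mul_conj_sum_of_ne b hb ξ (Ne.symm hne), mul_zero]]
  -- regroup by digit length and evaluate the diagonal terms
  rw [sum_Ico_one_pow b]
  refine Finset.sum_congr rfl fun ℓ _ => ?_
  rw [gainFactor_cast, blockVariance]
  push_cast
  rw [Finset.mul_sum]
  refine Finset.sum_congr rfl fun k hk => ?_
  rw [mem_Ico] at hk
  rw [integral_sum_mul_conj_sum_self b hb ξ hk.1 hk.2, Complex.mul_conj', mul_comm]

/-- **Variance of the scrambled-net estimator** [cite: DickPillichshammer2010, Cor. 13.4], on the
digit space and for a Walsh polynomial `f = Σ_{k < b^L} c_k wal_k`: if the `N` points with digit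
sequences `ξ_0, …, ξ_{N-1}` are scrambled by the same uniformly distributed nested scramble `Π`
(Owen's scrambling), then
`Var[Î(f)] = E|Î(f) - f̂(0)|² = N⁻² Σ_{ℓ=1}^{L} (b M_ℓ - M_{ℓ-1})/(b - 1) · σ_ℓ²(f)`
with `M_w` the number of ordered pairs of points sharing their first `w` base-`b` digits and
`σ_ℓ²(f) = Σ_{b^{ℓ-1} ≤ k < b^ℓ} |c_k|²`. (The book states it for `f ∈ L_2([0,1])`, `b` prime, with
`Σ_{ℓ ≥ 1}`; the passage from Walsh polynomials to `L_2` is Parseval's identity (13.6), not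
formalised here, and `b ≥ 2` arbitrary suffices for this statement.) -/
theorem integral_norm_sq_scrambledAverage_sub [NeZero b] (hb : 1 < b) [Nonempty κ]
    (ξ : κ → ℕ → Fin b) (L : ℕ) (c : ℕ → ℂ) :
    ∫ π, ‖scrambledAverage b π ξ (walshPoly b L c) - c 0‖ ^ 2 ∂scrambleMeasure b =
      ((Fintype.card κ : ℝ) ^ 2)⁻¹ * ∑ ℓ ∈ Icc 1 L, gainFactor b ℓ ξ * blockVariance b c ℓ := by
  have hb0 : 0 < b := Nat.pos_of_ne_zero (NeZero.ne b)
  have hN : (Fintype.card κ : ℂ) ≠ 0 := Nat.cast_ne_zero.2 Fintype.card_ne_zero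
  -- `Σ_n f(ξ_{n,Π}) = N c_0 + S(Π)`, so `Î(f) - c_0 = S(Π)/N`
  have hS : ∀ π : Scramble b, scrambledAverage b π ξ (walshPoly b L c) - c 0 =
      (Fintype.card κ : ℂ)⁻¹ *
        ∑ k ∈ Ico 1 (b ^ L), c k * ∑ n, walshD b k (scrambleDigits b π (ξ n)) := by
    intro π
    simp only [scrambledAverage, walshPoly]
    rw [Finset.sum_comm, Finset.range_eq_Ico,
      Finset.sum_eq_sum_Ico_succ_bot (Nat.one_le_pow _ _ hb0)]
    simp_rw [← Finset.mul_sum, walshD_zero, Finset.sum_const, Finset.card_univ, nsmul_eq_mul,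
      mul_one]
    field_simp
    ring
  simp_rw [hS, norm_mul, mul_pow, norm_inv, RCLike.norm_natCast, integral_const_mul,
    integral_norm_sq_sum b hb ξ L c, inv_pow]

end Family

/-! ### Theorem 13.5: scrambled `(t, m, 1)`-nets -/

/-- Appending one digit to a prefix: the length-`(w+1)` prefix of `ξ` is `(a, d)` iff its length-`w`
prefix is `a` and its digit `w` is `d`. [folklore] -/
private theorem digitsPrefix_succ_eq_snoc_iff {w : ℕ} (ξ : ℕ → Fin b) (a : Fin w → Fin b)
    (d : Fin b) : digitsPrefix b (w + 1) ξ = Fin.snoc a d ↔ digitsPrefix b w ξ = a ∧ ξ w = d := by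
  constructor
  · intro h
    refine ⟨funext fun i => ?_, ?_⟩
    · simpa [digitsPrefix] using congrFun h (Fin.castSucc i)
    · simpa [digitsPrefix] using congrFun h (Fin.last w)
  · rintro ⟨rfl, rfl⟩
    funext i
    refine Fin.lastCases ?_ (fun j => ?_) i
    · simp [digitsPrefix]
    · simp [digitsPrefix]

section Nets

variable {κ : Type*} [Fintype κ]

/-- **`(t, m, 1)`-net in base `b`**, on the digit space [cite: DickPillichshammer2010, Def. 4.7]
(with Remark 4.9 (1); dimension `s = 1`): a family of `b^m` points, given by their digit sequences
`ξ_n`, with `0 ≤ t ≤ m`, such that every `b`-adic elementary interval of order `m - t` contains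
exactly `b^t` of them — on the digit space, the interval `[A b^{-(m-t)}, (A+1) b^{-(m-t)})` is the
set of sequences whose first `m - t` digits are the base-`b` digits of `A`, i.e. a prescribed
`digitsPrefix b (m - t)`. -/
def IsDigitNet (t m : ℕ) (ξ : κ → ℕ → Fin b) : Prop :=
  t ≤ m ∧ Fintype.card κ = b ^ m ∧
    ∀ a : Fin (m - t) → Fin b, (univ.filter fun n => digitsPrefix b (m - t) (ξ n) = a).card = b ^ t

variable {b}

/-- The points with length-`w` prefix `a` split according to their digit `w`. [folklore] -/
private theorem card_filter_digitsPrefix_eq_sum (ξ : κ → ℕ → Fin b) (w : ℕ) (a : Fin w → Fin b) :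
    (univ.filter fun n => digitsPrefix b w (ξ n) = a).card =
      ∑ d : Fin b, (univ.filter fun n => digitsPrefix b (w + 1) (ξ n) = Fin.snoc a d).card := by
  rw [card_eq_sum_card_fiberwise (f := fun n => ξ n w) (t := univ) fun _ _ =>
    mem_coe.2 (mem_univ _)]
  refine sum_congr rfl fun d _ => ?_
  rw [filter_filter]
  exact congrArg _ (filter_congr fun n _ => (digitsPrefix_succ_eq_snoc_iff b (ξ n) a d).symm)

/-- A `(t, m, 1)`-net is fair at every order `w ≤ m - t`: each digit prefix of length `w` is the
prefix of exactly `b^{m-w}` points [cite: DickPillichshammer2010, Remark 4.9] ((2): an elementary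
interval of order `k - 1` is the disjoint union of `b` elementary intervals of order `k`, so every
`(t, m, s)`-net is a `(t+1, m, s)`-net). -/
theorem IsDigitNet.card_filter_digitsPrefix_eq {t m : ℕ} {ξ : κ → ℕ → Fin b}
    (h : IsDigitNet b t m ξ) {w : ℕ} (hw : w ≤ m - t) (a : Fin w → Fin b) :
    (univ.filter fun n => digitsPrefix b w (ξ n) = a).card = b ^ (m - w) := by
  obtain ⟨htm, -, hfair⟩ := h
  obtain ⟨k, hk⟩ : ∃ k, w + k = m - t := ⟨m - t - w, by omega⟩
  induction k generalizing w with
  | zero =>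
    obtain rfl : w = m - t := by omega
    rw [hfair a]
    congr 1
    omega
  | succ k ih =>
    rw [card_filter_digitsPrefix_eq_sum,
      sum_congr rfl fun d _ => ih (by omega) (Fin.snoc a d) (by omega), sum_const, card_univ,
      Fintype.card_fin, smul_eq_mul, (by omega : m - w = (m - (w + 1)) + 1), pow_succ']

/-- The same count, for the prefix of a given point. [folklore] -/
private theorem IsDigitNet.card_filter_digitsPrefix_eq' {t m : ℕ} {ξ : κ → ℕ → Fin b}
    (h : IsDigitNet b t m ξ) {w : ℕ} (hw : w ≤ m - t) (n : κ) :
    (univ.filter fun n' => digitsPrefix b w (ξ n) = digitsPrefix b w (ξ n')).card =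
      b ^ (m - w) := by
  rw [← h.card_filter_digitsPrefix_eq hw (digitsPrefix b w (ξ n))]
  exact congrArg _ (filter_congr fun _ _ => eq_comm)

/-- `M_w = Σ_n #{n' : ξ_{n'} shares its first w digits with ξ_n}`. [folklore] -/
private theorem prefixPairCount_eq_sum_card (w : ℕ) (ξ : κ → ℕ → Fin b) :
    prefixPairCount b w ξ =
      ∑ n, (univ.filter fun n' => digitsPrefix b w (ξ n) = digitsPrefix b w (ξ n')).card := by
  simp only [prefixPairCount, card_filter]
  rw [Fintype.sum_prod_type' (fun n n' : κ =>
    if digitsPrefix b w (ξ n) = digitsPrefix b w (ξ n') then 1 else 0)]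

/-- The diagonal pairs: `N ≤ M_w`. [folklore] -/
private theorem card_le_prefixPairCount (w : ℕ) (ξ : κ → ℕ → Fin b) :
    Fintype.card κ ≤ prefixPairCount b w ξ := by
  unfold prefixPairCount
  rw [← card_univ]
  exact card_le_card_of_injOn (fun n => (n, n)) (fun n _ => by simp)
    (fun n₁ _ n₂ _ hn => congrArg Prod.fst hn)

/-- `M_{w+1} ≤ M_w`: two points sharing `w + 1` digits share `w` digits. [folklore] -/
private theorem prefixPairCount_succ_le (w : ℕ) (ξ : κ → ℕ → Fin b) :
    prefixPairCount b (w + 1) ξ ≤ prefixPairCount b w ξ := by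
  unfold prefixPairCount
  refine card_le_card fun p hp => ?_
  simp only [mem_filter, mem_univ, true_and] at hp ⊢
  funext i
  simpa [digitsPrefix] using congrFun hp (Fin.castSucc i)

/-- `w ↦ M_w` is non-increasing. [folklore] -/
private theorem prefixPairCount_antitone (ξ : κ → ℕ → Fin b) :
    Antitone fun w => prefixPairCount b w ξ :=
  antitone_nat_of_succ_le fun w => prefixPairCount_succ_le w ξ

/-- `(b M_ℓ - M_{ℓ-1})/(b - 1) ≤ M_ℓ`, because `M_{ℓ-1} ≥ M_ℓ`
[cite: DickPillichshammer2010, Thm. 13.5] (proof, the `(t, m, 1)` case). -/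
theorem gainFactor_le_prefixPairCount (hb : 1 < b) (ℓ : ℕ) (ξ : κ → ℕ → Fin b) :
    gainFactor b ℓ ξ ≤ prefixPairCount b ℓ ξ := by
  have hb' : (0 : ℝ) < (b : ℝ) - 1 := sub_pos.2 (by exact_mod_cast hb)
  have hM : (prefixPairCount b ℓ ξ : ℝ) ≤ prefixPairCount b (ℓ - 1) ξ := by
    exact_mod_cast prefixPairCount_antitone ξ (Nat.sub_le ℓ 1)
  rw [gainFactor, div_le_iff₀ hb']
  linarith

/-- For a `(t, m, 1)`-net, `M_w = b^{2m-w}` (`= b^m · b^{m-w}`) for `0 ≤ w ≤ m - t`: each point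
shares its first `w` digits with exactly `b^{m-w}` points [cite: DickPillichshammer2010, Thm. 13.5]
(proof). -/
theorem IsDigitNet.prefixPairCount_eq {t m : ℕ} {ξ : κ → ℕ → Fin b} (h : IsDigitNet b t m ξ)
    {w : ℕ} (hw : w ≤ m - t) : prefixPairCount b w ξ = b ^ m * b ^ (m - w) := by
  rw [prefixPairCount_eq_sum_card, sum_congr rfl fun n _ => h.card_filter_digitsPrefix_eq' hw n,
    sum_const, card_univ, h.2.1, smul_eq_mul]

/-- For a `(0, m, 1)`-net and `w ≥ m`, `M_w = b^m`: distinct points have distinct length-`m`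
prefixes, so only the diagonal pairs remain [cite: DickPillichshammer2010, Thm. 13.5] (proof). -/
theorem IsDigitNet.prefixPairCount_eq_of_le {m : ℕ} {ξ : κ → ℕ → Fin b} (h : IsDigitNet b 0 m ξ)
    {w : ℕ} (hw : m ≤ w) : prefixPairCount b w ξ = b ^ m := by
  refine le_antisymm ?_ (h.2.1.symm.le.trans (card_le_prefixPairCount w ξ))
  calc prefixPairCount b w ξ ≤ prefixPairCount b m ξ := prefixPairCount_antitone ξ hw
    _ = b ^ m := by
      rw [h.prefixPairCount_eq (by omega : m ≤ m - 0), Nat.sub_self, pow_zero, mul_one]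

/-- For a `(t, m, 1)`-net the factor `(b M_ℓ - M_{ℓ-1})/(b - 1)` vanishes for `1 ≤ ℓ ≤ m - t`
[cite: DickPillichshammer2010, Thm. 13.5] (proof). -/
theorem IsDigitNet.gainFactor_eq_zero {t m : ℕ} {ξ : κ → ℕ → Fin b} (h : IsDigitNet b t m ξ)
    {ℓ : ℕ} (hℓ : 1 ≤ ℓ) (hℓ' : ℓ ≤ m - t) : gainFactor b ℓ ξ = 0 := by
  rw [gainFactor, h.prefixPairCount_eq hℓ', h.prefixPairCount_eq ((Nat.sub_le ℓ 1).trans hℓ'),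
    (by omega : m - (ℓ - 1) = (m - ℓ) + 1), pow_succ]
  push_cast
  ring

/-- … and is at most `b^{m+t}` for `ℓ > m - t` (as `M_ℓ ≤ M_{m-t} = b^{m+t}`)
[cite: DickPillichshammer2010, Thm. 13.5] (proof). -/
theorem IsDigitNet.gainFactor_le (hb : 1 < b) {t m : ℕ} {ξ : κ → ℕ → Fin b}
    (h : IsDigitNet b t m ξ) {ℓ : ℕ} (hℓ : m - t < ℓ) :
    gainFactor b ℓ ξ ≤ (b : ℝ) ^ m * (b : ℝ) ^ t := by
  have hM : (prefixPairCount b ℓ ξ : ℝ) ≤ prefixPairCount b (m - t) ξ := by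
    exact_mod_cast prefixPairCount_antitone ξ hℓ.le
  calc gainFactor b ℓ ξ ≤ prefixPairCount b ℓ ξ := gainFactor_le_prefixPairCount hb ℓ ξ
    _ ≤ prefixPairCount b (m - t) ξ := hM
    _ = (b : ℝ) ^ m * (b : ℝ) ^ t := by
      rw [h.prefixPairCount_eq le_rfl, (by have := h.1; omega : m - (m - t) = t)]
      simp only [Nat.cast_mul, Nat.cast_pow]

/-- For a `(0, m, 1)`-net the factor equals `b^m` for `ℓ > m`
[cite: DickPillichshammer2010, Thm. 13.5] (proof). -/
theorem IsDigitNet.gainFactor_eq_pow (hb : 1 < b) {m : ℕ} {ξ : κ → ℕ → Fin b}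
    (h : IsDigitNet b 0 m ξ) {ℓ : ℕ} (hℓ : m < ℓ) : gainFactor b ℓ ξ = (b : ℝ) ^ m := by
  have hb' : (b : ℝ) - 1 ≠ 0 := (sub_pos.2 (by exact_mod_cast hb : (1 : ℝ) < b)).ne'
  rw [gainFactor, h.prefixPairCount_eq_of_le hℓ.le,
    h.prefixPairCount_eq_of_le (by omega : m ≤ ℓ - 1)]
  push_cast
  rw [div_eq_iff hb']
  ring

/-- A net has at least one point. [folklore] -/
private theorem IsDigitNet.nonempty {t m : ℕ} {ξ : κ → ℕ → Fin b} [NeZero b]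
    (h : IsDigitNet b t m ξ) : Nonempty κ :=
  Fintype.card_pos_iff.1 (h.2.1 ▸ Nat.pow_pos (Nat.pos_of_ne_zero (NeZero.ne b)))

/-- **Variance for a scrambled `(0, m, 1)`-net** [cite: DickPillichshammer2010, Thm. 13.5] (first
part): if the `b^m` points form a `(0, m, 1)`-net in base `b`, then
`Var[Î(f)] = b^{-m} Σ_{ℓ > m} σ_ℓ²(f)` — here for a Walsh polynomial of degree `< b^L` on the digit
space, so the sum runs over `m < ℓ ≤ L` (and the variance vanishes when `L ≤ m`). -/
theorem IsDigitNet.integral_norm_sq_scrambledAverage_sub_eq [NeZero b] (hb : 1 < b) {m : ℕ}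
    {ξ : κ → ℕ → Fin b} (h : IsDigitNet b 0 m ξ) (L : ℕ) (c : ℕ → ℂ) :
    ∫ π, ‖scrambledAverage b π ξ (walshPoly b L c) - c 0‖ ^ 2 ∂scrambleMeasure b =
      ((b : ℝ) ^ m)⁻¹ * ∑ ℓ ∈ Ioc m L, blockVariance b c ℓ := by
  haveI := h.nonempty
  have hB : (b : ℝ) ^ m ≠ 0 := pow_ne_zero _ (by exact_mod_cast (NeZero.ne b))
  rw [integral_norm_sq_scrambledAverage_sub b hb ξ L c, h.2.1]
  have hsum : ∑ ℓ ∈ Icc 1 L, gainFactor b ℓ ξ * blockVariance b c ℓ =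
      ∑ ℓ ∈ Icc 1 L, if m < ℓ then (b : ℝ) ^ m * blockVariance b c ℓ else 0 := by
    refine sum_congr rfl fun ℓ hℓ => ?_
    rw [mem_Icc] at hℓ
    split_ifs with hm
    · rw [h.gainFactor_eq_pow hb hm]
    · rw [h.gainFactor_eq_zero hℓ.1 (by omega), zero_mul]
  have hI : (Icc 1 L).filter (fun ℓ => m < ℓ) = Ioc m L := by
    ext ℓ; simp only [mem_filter, mem_Icc, mem_Ioc]; omega
  rw [hsum, ← sum_filter, hI, ← mul_sum, ← mul_assoc]
  congr 1
  push_cast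
  rw [sq, mul_inv, mul_assoc, inv_mul_cancel₀ hB, mul_one]

/-- **Variance bound for a scrambled `(t, m, 1)`-net** [cite: DickPillichshammer2010, Thm. 13.5]
(second part): if the `b^m` points form a `(t, m, 1)`-net in base `b`, then
`Var[Î(f)] ≤ b^{t-m} Σ_{ℓ > m-t} σ_ℓ²(f)` (for a Walsh polynomial of degree `< b^L`: the sum over
`m - t < ℓ ≤ L`). -/
theorem IsDigitNet.integral_norm_sq_scrambledAverage_sub_le [NeZero b] (hb : 1 < b) {t m : ℕ}
    {ξ : κ → ℕ → Fin b} (h : IsDigitNet b t m ξ) (L : ℕ) (c : ℕ → ℂ) :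
    ∫ π, ‖scrambledAverage b π ξ (walshPoly b L c) - c 0‖ ^ 2 ∂scrambleMeasure b ≤
      (b : ℝ) ^ t / (b : ℝ) ^ m * ∑ ℓ ∈ Ioc (m - t) L, blockVariance b c ℓ := by
  haveI := h.nonempty
  have hB : (b : ℝ) ^ m ≠ 0 := pow_ne_zero _ (by exact_mod_cast (NeZero.ne b))
  rw [integral_norm_sq_scrambledAverage_sub b hb ξ L c, h.2.1]
  have hsum : ∑ ℓ ∈ Icc 1 L, gainFactor b ℓ ξ * blockVariance b c ℓ ≤
      ∑ ℓ ∈ Icc 1 L, if m - t < ℓ then (b : ℝ) ^ m * (b : ℝ) ^ t * blockVariance b c ℓ else 0 := by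
    refine sum_le_sum fun ℓ hℓ => ?_
    rw [mem_Icc] at hℓ
    split_ifs with hm
    · exact mul_le_mul_of_nonneg_right (h.gainFactor_le hb hm) (blockVariance_nonneg b c ℓ)
    · rw [h.gainFactor_eq_zero hℓ.1 (by omega), zero_mul]
  have hI : (Icc 1 L).filter (fun ℓ => m - t < ℓ) = Ioc (m - t) L := by
    ext ℓ; simp only [mem_filter, mem_Icc, mem_Ioc]; omega
  rw [← sum_filter, hI, ← mul_sum] at hsum
  refine (mul_le_mul_of_nonneg_left hsum (by positivity)).trans_eq ?_
  push_cast
  rw [← mul_assoc]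
  congr 1
  rw [sq, mul_inv, mul_assoc, ← mul_assoc _ ((b : ℝ) ^ m), inv_mul_cancel₀ hB, one_mul,
    div_eq_mul_inv, mul_comm]

end Nets

end Literature.Analysis.Quadrature

end
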